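import Literature.Probability.Percolation.KozmaNitzanGoodQuadruple
import HarnessLib

/-!
# Kozma–Nitzan GOODNESS at a BRANCHING observer: the star-peeling reduction (generalised Theorem 5)
# (`NoHeavyLowerTail` cell, stmt-CriticalPhenomena-4575; new-inequality factory seat `prim-ineq-gen-7`, gen 3)

Support file (`--supports stmt-CriticalPhenomena-4575`).  No definitions, no named facts, no sorries.

Kozma–Nitzan (arXiv:2401.12397, §3.2) call `(G, A, 0, b)` GOOD if
`P(0 ↔ b) ≥ min_a P(a ↔ b) − Σ_{W ∩ A = ∅} P(C(0) = W) · min_a P_{G∖W}(a ↔ b)` (tree: `KNGood`; Theorem 4 — `0`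
isolated in `G ∖ A` — and Theorem 5 — ONE further neighbour `x` with `(G ∖ 0, A, x, b)` good — are proved as printed in
`Literature.Probability.Percolation.KozmaNitzanGoodQuadruple`).  Their proof peels the observer along its stars
`σ_B = {the open pairs at 0 are exactly those to B}`: on stars meeting `A`, Lemma 5 compares `0` with the relay `a₀`
minimising `P_{G∖0}(· ↔ b)`; the single Steiner star `σ_{x}` is the induction hypothesis.  This file records the same
bookkeeping for an observer with ANY finite set `X` of non-relay neighbours, isolating the exact residual hypothesis:

* `KNGoodBranching.knGood_of_starNeed` — **let `o ∉ A` have positive-weight pairs only towards `A ∪ X` (`X` non-relays), let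
  `a₀ ∈ A` minimise `P_{G∖0}(a ↔ b)` (paths avoiding `0`), and suppose that for every nonempty `B ⊆ X` the STAR INEQUALITY
  `NEED(B)`:  `P(a₀ ↔ b, σ_B) ≤ P(0 ↔ b, σ_B) + Σ_{W ∩ A = ∅, W ≠ {0}} P(C(0) = W, σ_B) · min_a P_{G∖W}(a ↔ b)`  holds.
  Then `(G, A, 0, b)` is good.**  (Stars meeting `A` need nothing: Lemma 5.  Summing `NEED(B)` over all stars and using that
  the stars partition the space (`KNPreFKG.real_eq_sum_inter_starEvent`) turns the per-star corrections into exactly the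
  `W ≠ {0}` correction terms of goodness, and the empty star into the `W = {0}` term.)
* `KNGoodBranching.knGood_of_starNeed'` — the same with the minimiser `a₀` produced inside (hypothesis quantified over
  all `G∖0`-minimisers).

`NEED(B)` divided by `P(σ_B)` is "displaced goodness" of the star-conditioned graph (the children in `B` glued to `0`, the other
pairs at `0` closed) AT THE RELAY `a₀` — the minimiser of `G ∖ 0`, not of the conditioned graph minus its observer; for
`B = {x}` the two coincide and `NEED({x})` is Theorem 5's hypothesis.  This is the `agood(G_S, x_S; a₀) ≥ 0` condition of
prover `prim-hp-2`'s memo (run/shared/lean/prim/prim-hp-2/MEMO-gen3-goodness-monotonicity.md §2, "Conjecture M / GC"), found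
independently by this seat as the split-worst lemma (run/shared/lean/prim/prim-ineq-gen-7/FINDING-TREE-g3.md §2–3); census: `NEED(B)`
holds in 42 243 / 42 243 star terms of random branching Steiner-tree instances and the split-worst form in 144 369 / 144 369 random
splits (exact arithmetic), while the naive induction hypothesis (worst relay of the conditioned graph minus its observer) is too
weak in 169 / 42 243.  No tree hypothesis is used here: the reduction holds for every finite weighted graph.
[cite: KozmaNitzan2024, §3.2 Definition, Theorems 4–5 and their proof (pp. 12–14); Lemma 5 (p. 13)]
-/

noncomputable section

namespace Summit.CriticalPhenomena.PercolationContinuityZ3.Theorems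

open MeasureTheory Set Literature.Probability.LatticeModels Literature.Probability.Percolation
open scoped Classical BigOperators

namespace KNGoodBranching

open KNGoodAux

variable {V : Type*} [Fintype V] [DecidableEq V]

/-- **Star-peeling reduction of Kozma–Nitzan goodness at a branching observer (generalised Theorem 5).**
`o ∉ A` has positive-weight pairs only towards `A ∪ X` (`o ∉ X`); `a₀ ∈ A` minimises `P_{G∖0}(a ↔ b) = μ(openConnIn {o}ᶜ a b)`;
for every nonempty `B ⊆ X` the star inequality
`μ(a₀ ↔ b, σ_B) ≤ μ(o ↔ b, σ_B) + Σ_{W ∈ nullSets A, W ≠ {o}} μ(C(o) = W, σ_B) · inf'_a μ(a ↔ b off W)` holds.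
Then `KNGood w A hA o b`.  (Stars meeting `A`: Lemma 5; `B = ∅`: the `W = {o}` term; the stars partition the space.)
[cite: KozmaNitzan2024, proof of Thms. 4–5 (pp. 13–14)] -/
theorem knGood_of_starNeed (w : Sym2 V → unitInterval) (A X : Finset V) (hA : A.Nonempty) (o b : V)
    (hoA : o ∉ A) (hoX : o ∉ X)
    (hiso : ∀ u, u ≠ o → u ∉ A → u ∉ X → w s(o, u) = 0)
    (a₀ : V) (ha₀ : a₀ ∈ A)
    (hmin : ∀ a ∈ A, (prodBernoulli w).real (openConnIn ({o}ᶜ : Set V) a₀ b) ≤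
      (prodBernoulli w).real (openConnIn ({o}ᶜ : Set V) a b))
    (hneed : ∀ B : Finset V, B ⊆ X → B.Nonempty →
      (prodBernoulli w).real (openConn a₀ b ∩ starEvent o (↑B : Set V)) ≤
        (prodBernoulli w).real (openConn o b ∩ starEvent o (↑B : Set V)) +
          ∑ W ∈ (nullSets A).erase {o},
            (prodBernoulli w).real (clusterIs o W ∩ starEvent o (↑B : Set V)) *
              A.inf' hA (fun a => (prodBernoulli w).real (openConnIn ((↑W : Set V)ᶜ) a b))) :
    KNGood w A hA o b := by
  set μ := prodBernoulli w with hμ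
  set c : Finset V → ℝ := fun W => A.inf' hA (fun a => μ.real (openConnIn ((↑W : Set V)ᶜ) a b)) with hc
  set g : Finset V → ℝ := fun W => μ.real (clusterIs o W) * c W with hg
  have hc0 : ∀ W, 0 ≤ c W := fun W => (Finset.le_inf'_iff hA _).2 fun a _ => measureReal_nonneg
  have hg0 : ∀ W, 0 ≤ g W := fun W => mul_nonneg measureReal_nonneg (hc0 W)
  -- `A ∪ X` isolates `o`
  set A' : Finset V := A ∪ X with hA'
  have hoA' : o ∉ A' := by
    rw [hA', Finset.mem_union]; rintro (h | h); exact hoA h; exact hoX h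
  have hiso' : ∀ u, u ≠ o → u ∉ A' → w s(o, u) = 0 := by
    intro u huo huA'
    rw [hA', Finset.mem_union, not_or] at huA'
    exact hiso u huo huA'.1 huA'.2
  have ha₀o : a₀ ≠ o := fun h => hoA (h ▸ ha₀)
  have hAo : ∀ a ∈ A, a ≠ o := fun a ha h => hoA (h ▸ ha)
  -- per-star corrections
  set corr : Finset V → ℝ := fun B => ∑ W ∈ (nullSets A).erase {o},
      μ.real (clusterIs o W ∩ starEvent o (↑B : Set V)) * c W with hcorr
  have hcorr0 : ∀ B, 0 ≤ corr B := fun B =>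
    Finset.sum_nonneg fun W _ => mul_nonneg measureReal_nonneg (hc0 W)
  -- star decompositions over `B ⊆ A ∪ X`
  set P := A'.powerset with hP
  have h0P : (∅ : Finset V) ∈ P := Finset.mem_powerset.2 (Finset.empty_subset _)
  have hdec0 : μ.real (openConn o b) = ∑ B ∈ P, μ.real (openConn o b ∩ starEvent o ↑B) :=
    KNPreFKG.real_eq_sum_inter_starEvent w A' o hoA' hiso' (openConn o b)
  have hdec1 : μ.real (openConn a₀ b) = ∑ B ∈ P, μ.real (openConn a₀ b ∩ starEvent o ↑B) :=
    KNPreFKG.real_eq_sum_inter_starEvent w A' o hoA' hiso' (openConn a₀ b)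
  have hsplit : ∀ f : Finset V → ℝ, ∑ B ∈ P, f B = f ∅ + ∑ B ∈ P.erase ∅, f B := fun f =>
    (Finset.add_sum_erase _ _ h0P).symm
  -- termwise bound on the nonempty stars: Lemma 5 on stars meeting `A`, `NEED(B)` on the Steiner stars
  have hterm : ∀ B ∈ P.erase ∅, μ.real (openConn a₀ b ∩ starEvent o ↑B) ≤
      μ.real (openConn o b ∩ starEvent o ↑B) + corr B := by
    intro B hB
    obtain ⟨hBne, hBP⟩ := Finset.mem_erase.1 hB
    have hBA' : B ⊆ A' := Finset.mem_powerset.1 hBP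
    by_cases hBA : ∃ v ∈ B, v ∈ A
    · obtain ⟨v, hvB, hvA⟩ := hBA
      have h5 := KozmaNitzan2024_lemma5_fintype w o b a₀ v (↑B) ha₀o (hAo v hvA) (Finset.mem_coe.2 hvB)
        (hmin v hvA)
      linarith [hcorr0 B]
    · push Not at hBA
      have hBX : B ⊆ X := by
        intro v hv
        have h := hBA' hv
        rw [hA', Finset.mem_union] at h
        exact h.resolve_left (hBA v hv)
      exact hneed B hBX (Finset.nonempty_iff_ne_empty.2 hBne)
  -- the empty star of `a₀` is the `W = {o}` correction term
  have hW0 : μ.real (openConn a₀ b ∩ starEvent o ↑(∅ : Finset V)) = g {o} := by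
    rw [Finset.coe_empty, real_openConn_inter_starEvent_empty w o ha₀o b, hg, hc]
    simp only
    rw [Finset.coe_singleton]
    congr 1
    exact (le_antisymm (Finset.inf'_le (fun a => μ.real (openConnIn ({o}ᶜ : Set V) a b)) ha₀)
      ((Finset.le_inf'_iff hA (fun a => μ.real (openConnIn ({o}ᶜ : Set V) a b))).2 hmin)).symm
  -- the per-star corrections sum to the `W ≠ {o}` correction terms (the stars partition the space)
  have hsumcorr : ∑ B ∈ P, corr B = ∑ W ∈ (nullSets A).erase {o}, g W := by
    rw [hcorr, Finset.sum_comm]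
    refine Finset.sum_congr rfl fun W _ => ?_
    rw [← Finset.sum_mul, ← KNPreFKG.real_eq_sum_inter_starEvent w A' o hoA' hiso' (clusterIs o W)]
  have hmemW : ({o} : Finset V) ∈ nullSets A := by
    rw [mem_nullSets, Finset.disjoint_singleton_left]; exact hoA
  have hCORRsplit : ∑ W ∈ nullSets A, g W = g {o} + ∑ W ∈ (nullSets A).erase {o}, g W :=
    (Finset.add_sum_erase _ _ hmemW).symm
  -- assemble
  have hinf : A.inf' hA (fun a => μ.real (openConn a b)) ≤ μ.real (openConn a₀ b) := Finset.inf'_le _ ha₀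
  have hsum1 : ∑ B ∈ P.erase ∅, μ.real (openConn a₀ b ∩ starEvent o ↑B) ≤
      ∑ B ∈ P.erase ∅, (μ.real (openConn o b ∩ starEvent o ↑B) + corr B) := Finset.sum_le_sum hterm
  rw [Finset.sum_add_distrib] at hsum1
  have hcorr_le : ∑ B ∈ P.erase ∅, corr B ≤ ∑ B ∈ P, corr B := by
    rw [hsplit corr]; linarith [hcorr0 ∅]
  have h00 : 0 ≤ μ.real (openConn o b ∩ starEvent o ↑(∅ : Finset V)) := measureReal_nonneg
  show A.inf' hA (fun a => μ.real (openConn a b)) - ∑ W ∈ nullSets A, g W ≤ μ.real (openConn o b)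
  rw [hdec0, hsplit, hCORRsplit]
  rw [hdec1, hsplit, hW0] at hinf
  linarith [hinf, hsum1, hcorr_le, hsumcorr, h00]

/-- **The same reduction with the minimiser produced inside**: if `NEED(B)` holds for EVERY relay `a₀ ∈ A` minimising
`P_{G∖0}(a ↔ b)` and every nonempty Steiner star `B ⊆ X`, then `(G, A, 0, b)` is good.
[cite: KozmaNitzan2024, proof of Thms. 4–5 (pp. 13–14)] -/
theorem knGood_of_starNeed' (w : Sym2 V → unitInterval) (A X : Finset V) (hA : A.Nonempty) (o b : V)
    (hoA : o ∉ A) (hoX : o ∉ X)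
    (hiso : ∀ u, u ≠ o → u ∉ A → u ∉ X → w s(o, u) = 0)
    (hneed : ∀ a₀ ∈ A, (∀ a ∈ A, (prodBernoulli w).real (openConnIn ({o}ᶜ : Set V) a₀ b) ≤
        (prodBernoulli w).real (openConnIn ({o}ᶜ : Set V) a b)) →
      ∀ B : Finset V, B ⊆ X → B.Nonempty →
      (prodBernoulli w).real (openConn a₀ b ∩ starEvent o (↑B : Set V)) ≤
        (prodBernoulli w).real (openConn o b ∩ starEvent o (↑B : Set V)) +
          ∑ W ∈ (nullSets A).erase {o},
            (prodBernoulli w).real (clusterIs o W ∩ starEvent o (↑B : Set V)) *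
              A.inf' hA (fun a => (prodBernoulli w).real (openConnIn ((↑W : Set V)ᶜ) a b))) :
    KNGood w A hA o b := by
  obtain ⟨a₀, ha₀, hmin⟩ :=
    A.exists_min_image (fun a => (prodBernoulli w).real (openConnIn ({o}ᶜ : Set V) a b)) hA
  exact knGood_of_starNeed w A X hA o b hoA hoX hiso a₀ ha₀ hmin (hneed a₀ ha₀ hmin)

end KNGoodBranching

end Summit.CriticalPhenomena.PercolationContinuityZ3.Theorems
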